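import Summits.HubbardSuperconductivity.HubbardSuperconductivity.Theorems.AnisotropyChordTransferFibre3KT2aRow
import Summits.HubbardSuperconductivity.HubbardSuperconductivity.Theorems.AnisotropyChordTransferFibre3TwoMagnonQF

/-!
# Route `AnisotropyChord` / H0 rotor rung: PartN41-D §3 — FACT 1 `C0FormJU` PROVED (the pure-jump `C0` monomial vanishes off `D`)

Theory-1 g22's PartN41-D §3 `C0FormJU` (port …Fibre3KT2aRow): with the uniform-with-hole profile `f_JU = a(1 − δ₀)` a lattice
gradient `D_e f_JU(x)` vanishes unless `x ∈ {0, e}` (★ `Dgrad_fJU_eq_zero`), and in each of the twelve products of the trilinear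
`C0` form two such gradients (or one gradient and the hard-core constraint) would force the configuration onto `D`; hence
★ `c0FormJU_holds (Δ) : C0FormJU L Δ`.
Prover seat `hubbard-h0-rotor-p1` g27 (route lead); helper for stmt-HubbardSuperconductivity-23918 (`--supports`, helper class).
WHAT THIS IS NOT: nothing here proves superconductivity in the Hubbard model.  Tree imports only; no new definitions; no sorry.
-/

set_option linter.dupNamespace false
set_option autoImplicit false

noncomputable section

open scoped BigOperators

namespace Summit.HubbardSuperconductivity.HubbardSuperconductivity.Theorems.AnisotropyChord.Transfer.Fibre3

variable (L : ℕ) [NeZero L]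

namespace RowD

omit [NeZero L] in
/-- `D_e f_JU(x) = 0` when `x ≠ 0` and `x − e ≠ 0`. [folklore] -/
theorem Dgrad_fJU_eq_zero (Δ : ℝ) (f : Tor L → ℝ) (e x : Tor L) (hx : x ≠ 0) (hxe : x - e ≠ 0) :
    Dgrad L (fJU L Δ f) e x = 0 := by
  unfold Dgrad fJU
  rw [if_neg hx, if_neg hxe, sub_self]

omit [NeZero L] in
/-- each directional summand of the pure-jump `C0` monomial vanishes off `D`. [folklore] -/
theorem c0formJU_summand (Δ : ℝ) (f : Tor L → ℝ) (c : Cfg L) (h1 : c.1 ≠ 0) (h2 : c.2 ≠ 0) (h12 : c.1 ≠ c.2)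
    (e : Tor L) :
    fJU L Δ f (c.2 - c.1) * Dgrad L (fJU L Δ f) e c.1 * Dgrad L (fJU L Δ f) e c.2
      + fJU L Δ f c.2 * Dgrad L (fJU L Δ f) (-e) c.1 * Dgrad L (fJU L Δ f) e (c.2 - c.1)
      + fJU L Δ f c.1 * Dgrad L (fJU L Δ f) e c.2 * Dgrad L (fJU L Δ f) e (c.2 - c.1) = 0 := by
  have h21 : c.2 - c.1 ≠ 0 := sub_ne_zero.mpr (Ne.symm h12)
  -- term 1
  have t1 : Dgrad L (fJU L Δ f) e c.1 * Dgrad L (fJU L Δ f) e c.2 = 0 := by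
    by_cases ha : c.1 - e = 0
    · have hb : c.2 - e ≠ 0 := by
        intro hb; apply h12
        have := sub_eq_zero.mp ha; have := sub_eq_zero.mp hb
        simp_all
      rw [Dgrad_fJU_eq_zero L Δ f e c.2 h2 hb, mul_zero]
    · rw [Dgrad_fJU_eq_zero L Δ f e c.1 h1 ha, zero_mul]
  -- term 2
  have t2 : Dgrad L (fJU L Δ f) (-e) c.1 * Dgrad L (fJU L Δ f) e (c.2 - c.1) = 0 := by
    by_cases ha : c.1 - -e = 0
    · have hc : c.2 - c.1 - e ≠ 0 := by
        have : c.1 = -e := by rw [sub_neg_eq_add] at ha; exact eq_neg_of_add_eq_zero_left ha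
        rw [this]; simpa using h2
      rw [Dgrad_fJU_eq_zero L Δ f e (c.2 - c.1) h21 hc, mul_zero]
    · rw [Dgrad_fJU_eq_zero L Δ f (-e) c.1 h1 ha, zero_mul]
  -- term 3
  have t3 : Dgrad L (fJU L Δ f) e c.2 * Dgrad L (fJU L Δ f) e (c.2 - c.1) = 0 := by
    by_cases hb : c.2 - e = 0
    · have hc : c.2 - c.1 - e ≠ 0 := by
        have : c.2 = e := sub_eq_zero.mp hb
        rw [this, show e - c.1 - e = -c.1 by abel]; exact neg_ne_zero.mpr h1
      rw [Dgrad_fJU_eq_zero L Δ f e (c.2 - c.1) h21 hc, mul_zero]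
    · rw [Dgrad_fJU_eq_zero L Δ f e c.2 h2 hb, zero_mul]
  calc fJU L Δ f (c.2 - c.1) * Dgrad L (fJU L Δ f) e c.1 * Dgrad L (fJU L Δ f) e c.2
        + fJU L Δ f c.2 * Dgrad L (fJU L Δ f) (-e) c.1 * Dgrad L (fJU L Δ f) e (c.2 - c.1)
        + fJU L Δ f c.1 * Dgrad L (fJU L Δ f) e c.2 * Dgrad L (fJU L Δ f) e (c.2 - c.1)
      = fJU L Δ f (c.2 - c.1) * (Dgrad L (fJU L Δ f) e c.1 * Dgrad L (fJU L Δ f) e c.2)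
        + fJU L Δ f c.2 * (Dgrad L (fJU L Δ f) (-e) c.1 * Dgrad L (fJU L Δ f) e (c.2 - c.1))
        + fJU L Δ f c.1 * (Dgrad L (fJU L Δ f) e c.2 * Dgrad L (fJU L Δ f) e (c.2 - c.1)) := by ring
    _ = 0 := by rw [t1, t2, t3]; ring

end RowD

omit [NeZero L] in
/-- ★ **`C0FormJU L Δ` holds.** [folklore] -/
theorem c0FormJU_holds (Δ : ℝ) : C0FormJU L Δ := by
  intro f c hc
  have hc' := hc
  unfold InD at hc'
  simp only [Bool.or_eq_false_iff, decide_eq_false_iff_not] at hc'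
  obtain ⟨⟨h1, h2⟩, h12⟩ := hc'
  unfold c0form3
  rw [nnList_map_sum]
  simp only [RowD.c0formJU_summand L Δ f c h1 h2 h12]
  ring

end Summit.HubbardSuperconductivity.HubbardSuperconductivity.Theorems.AnisotropyChord.Transfer.Fibre3

end
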